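import Mathlib
import Literature.Analysis.ValidatedNumerics.IntervalPolynomial
import HarnessLib

/-!
# Negative knowledge on crux `LeftRightFKG`, part 8: kernel certificates for the sign of a `2 × 2`
minor of partition polynomials on a fugacity window (certified-compute lane)

Every finite instance of the crux `LeftRightFKG` (stmt-CriticalPhenomena-11232) and of the line's stub
`CornerCritical` (line `corner-localisation`) is, after exact enumeration of the self-avoiding chords, an
inequality `Z₁₂(x_c) Z₂₁(x_c) ≤ Z₁₁(x_c) Z₂₂(x_c)` between four PARTITION POLYNOMIALS
`Z(x) = Σ_γ x^{|γ|} = Σₙ cₙ xⁿ` with natural coefficients (`cₙ` = number of chords of length `n` in the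
event), at the critical fugacity `x_c = 1/μ(ℤ²)`, which the tree only knows through the enclosure
`2.6 ≤ μ(ℤ²) ≤ 2.695`, i.e. `x_c ∈ [200/539, 5/13]`.  This file is the thin ADAPTER that turns such an
inequality, for explicit coefficient lists, into one `decide +kernel` on the tree's validated-numerics
sign checker `Literature.Analysis.ValidatedNumerics.PolyMP.posOn` (interval Taylor shift + tail bound +
bisection, soundness `PolyMP.posOn_sound`, `IntervalPolynomial.lean`):

* `realOf cs` (the real coefficient list of `cs : List ℤ`), `intPoly S cs` (the same list as thin
  intervals at scale `S`) and the membership `pmem_intPoly`;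
* `minorR m₁₁ m₂₂ m₁₂ m₂₁` / `minorI S …`: the real list and the interval polynomial of the minor
  `Z₁₁ Z₂₂ − Z₁₂ Z₂₁`, with `pmem_minorI` and the evaluation identity `evalR_minorR`;
* **`minor_pos_of_posOn`**: `PolyMP.posOn S d (minorI S m₁₁ m₂₂ m₁₂ m₂₁) lo hi = true` ⟹
  `Z₁₂(x) Z₂₁(x) < Z₁₁(x) Z₂₂(x)` for every real `x ∈ [lo, hi]` (`Z = PolyMP.evalR ∘ realOf`);
* `evalR_realOf_eq_sum`: `PolyMP.evalR (realOf cs) x = Σᵢ cs[i] · xⁱ` (the bridge to partition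
  functions written as finite sums, used by the `SAW.weight`-level certificates).

The certificates themselves (`CornerCert*.lean`) are data + one `decide +kernel` each; the step from the
window to `x_c` uses the computational-grade enclosure lemmas and lives in `CornerCertXc.lean`.
Everything here is elementary ("folklore"); no facts, no axioms.
-/

namespace Summit.CriticalPhenomena.SAWScalingLimit.Theorems.LeftRightFKG.Negative.PolyCert

open Literature.Analysis.ValidatedNumerics Literature.Analysis.ValidatedNumerics.NumericsMP
open PolyMP (evalR addR mulR IPoly PMem addI mulI posOn)

/-! ## Integer coefficient lists as real lists and as thin interval polynomials -/

/-- The real coefficient list of an integer coefficient list. [folklore] -/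
noncomputable def realOf (cs : List ℤ) : List ℝ := cs.map fun c => (c : ℝ)

/-- The integer coefficient list as an interval polynomial of THIN intervals at scale `S`. [folklore] -/
def intPoly (S : ℕ) (cs : List ℤ) : IPoly := cs.map (MI.ofInt S)

/-- `realOf_nil` (auxiliary). [folklore] -/
@[simp] theorem realOf_nil : realOf [] = [] := rfl

/-- `realOf_cons` (auxiliary). [folklore] -/
@[simp] theorem realOf_cons (c : ℤ) (cs : List ℤ) : realOf (c :: cs) = (c : ℝ) :: realOf cs := rfl

/-- The thin interval polynomial encloses the real list (exactly). [folklore] -/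
theorem pmem_intPoly (S : ℕ) : ∀ cs : List ℤ, PMem S (realOf cs) (intPoly S cs)
  | [] => PolyMP.pmem_nil S
  | c :: cs => by
    simp only [realOf_cons, intPoly, List.map_cons]
    exact PolyMP.pmem_cons (MI.mem_ofInt S c) (pmem_intPoly S cs)

/-- **Evaluation as a finite sum**: `evalR (realOf cs) x = Σ_{i < |cs|} cs[i] · xⁱ`. [folklore] -/
theorem evalR_realOf_eq_sum : ∀ (cs : List ℤ) (x : ℝ),
    evalR (realOf cs) x = ∑ i ∈ Finset.range cs.length, (cs.getD i 0 : ℝ) * x ^ i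
  | [], x => by simp [realOf]
  | c :: cs, x => by
    rw [realOf_cons, PolyMP.evalR_cons, evalR_realOf_eq_sum cs x, List.length_cons,
      Finset.sum_range_succ', Finset.mul_sum]
    simp only [List.getD_cons_succ, List.getD_cons_zero, pow_zero, mul_one]
    rw [add_comm]
    congr 1
    exact Finset.sum_congr rfl fun i _ => by ring

/-! ## The minor of four partition lists -/

/-- The real coefficient list of the minor `Z₁₁ Z₂₂ − Z₁₂ Z₂₁`. [folklore] -/
noncomputable def minorR (m11 m22 m12 m21 : List ℤ) : List ℝ :=
  addR (mulR (realOf m11) (realOf m22)) ((mulR (realOf m12) (realOf m21)).map Neg.neg)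

/-- The interval polynomial of the minor at scale `S` (thin integer intervals; all products are exact,
the outward rounding is vacuous). [folklore] -/
def minorI (S : ℕ) (m11 m22 m12 m21 : List ℤ) : IPoly :=
  addI (mulI S (intPoly S m11) (intPoly S m22)) ((mulI S (intPoly S m12) (intPoly S m21)).map MI.neg)

/-- The interval minor encloses the real minor. [folklore] -/
theorem pmem_minorI {S : ℕ} (hS : 0 < S) (m11 m22 m12 m21 : List ℤ) :
    PMem S (minorR m11 m22 m12 m21) (minorI S m11 m22 m12 m21) :=
  PolyMP.pmem_addI (PolyMP.pmem_mulI hS (pmem_intPoly S m11) (pmem_intPoly S m22))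
    (PolyMP.pmem_neg (PolyMP.pmem_mulI hS (pmem_intPoly S m12) (pmem_intPoly S m21)))

/-- The real minor evaluates to `Z₁₁ Z₂₂ − Z₁₂ Z₂₁`. [folklore] -/
theorem evalR_minorR (m11 m22 m12 m21 : List ℤ) (x : ℝ) :
    evalR (minorR m11 m22 m12 m21) x =
      evalR (realOf m11) x * evalR (realOf m22) x - evalR (realOf m12) x * evalR (realOf m21) x := by
  rw [minorR, PolyMP.evalR_addR, PolyMP.evalR_map_neg, PolyMP.evalR_mulR, PolyMP.evalR_mulR]
  ring

/-- **TP₂ certificate for a `2 × 2` block of partition lists on a window**: a successful run of the tree's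
sign checker on the interval minor gives the STRICT minor inequality for every real fugacity in the
window. [folklore] -/
theorem minor_pos_of_posOn {S d : ℕ} (hS : 0 < S) {m11 m22 m12 m21 : List ℤ} {lo hi : ℚ}
    (h : posOn S d (minorI S m11 m22 m12 m21) lo hi = true) (hle : lo ≤ hi) {x : ℝ}
    (hlo : (lo : ℝ) ≤ x) (hhi : x ≤ (hi : ℝ)) :
    evalR (realOf m12) x * evalR (realOf m21) x < evalR (realOf m11) x * evalR (realOf m22) x := by
  have hpos := PolyMP.posOn_sound hS h hle (pmem_minorI hS m11 m22 m12 m21) hlo hhi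
  rw [evalR_minorR] at hpos
  linarith

/-- The same on `Set.Icc`, non-strict form (the shape of the crux's inequality). [folklore] -/
theorem minor_le_of_posOn {S d : ℕ} (hS : 0 < S) {m11 m22 m12 m21 : List ℤ} {lo hi : ℚ}
    (h : posOn S d (minorI S m11 m22 m12 m21) lo hi = true) (hle : lo ≤ hi) :
    ∀ x ∈ Set.Icc (lo : ℝ) (hi : ℝ),
      evalR (realOf m12) x * evalR (realOf m21) x ≤ evalR (realOf m11) x * evalR (realOf m22) x :=
  fun _ hx => (minor_pos_of_posOn hS h hle hx.1 hx.2).le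

/-- Partition lists have non-negative values at non-negative fugacity when their coefficients are
non-negative (chord counts). [folklore] -/
theorem evalR_realOf_nonneg {cs : List ℤ} (h : ∀ c ∈ cs, 0 ≤ c) {x : ℝ} (hx : 0 ≤ x) :
    0 ≤ evalR (realOf cs) x := by
  induction cs with
  | nil => simp [realOf]
  | cons c cs ih =>
    rw [realOf_cons, PolyMP.evalR_cons]
    have hc : (0 : ℝ) ≤ c := by exact_mod_cast h c List.mem_cons_self
    have := ih fun d hd => h d (List.mem_cons_of_mem _ hd)
    positivity

/-! ## Shifting out common powers of `x` (appended 2026-08-16)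

Partition lists of chords start with many zeros (no chord is shorter than the lattice distance); the sign checker is
much faster on the REDUCED lists, and the minor inequality transfers when the exponents balance. -/

/-- `realOf` of a block of `k` zeros followed by `cs`. [folklore] -/
theorem realOf_replicate_append (k : ℕ) (cs : List ℤ) :
    realOf (List.replicate k 0 ++ cs) = List.replicate k 0 ++ realOf cs := by
  induction k with
  | zero => rfl
  | succ k ih =>
    rw [List.replicate_succ, List.cons_append, realOf_cons, ih, Int.cast_zero]
    rfl

/-- Evaluation of a list shifted by `k` zeros: `Z(x) = xᵏ · Z_reduced(x)`. [folklore] -/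
theorem evalR_realOf_replicate_append (k : ℕ) (cs : List ℤ) (x : ℝ) :
    evalR (realOf (List.replicate k 0 ++ cs)) x = x ^ k * evalR (realOf cs) x := by
  rw [realOf_replicate_append]
  induction k with
  | zero => simp
  | succ k ih => rw [List.replicate_succ, List.cons_append, PolyMP.evalR_cons, ih, zero_add, pow_succ]; ring

/-- **Transfer of the minor inequality through balanced shifts**: if `k₁₁ + k₂₂ = k₁₂ + k₂₁` and the reduced
minor is positive at `x > 0`, so is the full one. [folklore] -/
theorem shifted_minor_lt {x a b c d : ℝ} (hx : 0 < x) {k11 k22 k12 k21 : ℕ} (hk : k11 + k22 = k12 + k21)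
    (h : c * d < a * b) :
    x ^ k12 * c * (x ^ k21 * d) < x ^ k11 * a * (x ^ k22 * b) := by
  have hpow : 0 < x ^ (k11 + k22) := pow_pos hx _
  calc x ^ k12 * c * (x ^ k21 * d) = x ^ (k11 + k22) * (c * d) := by rw [hk, pow_add]; ring
    _ < x ^ (k11 + k22) * (a * b) := mul_lt_mul_of_pos_left h hpow
    _ = x ^ k11 * a * (x ^ k22 * b) := by rw [pow_add]; ring

/-- **TP₂ certificate on REDUCED lists**: `posOn` on the minor of the reduced lists `r₁₁, r₂₂, r₁₂, r₂₁` with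
balanced shifts `kᵢⱼ` gives the strict minor inequality for the full partition lists
`List.replicate kᵢⱼ 0 ++ rᵢⱼ` on the window (`0 < lo`). [folklore] -/
theorem minor_pos_of_posOn_reduced {S d : ℕ} (hS : 0 < S) {r11 r22 r12 r21 : List ℤ} {lo hi : ℚ}
    (h : posOn S d (minorI S r11 r22 r12 r21) lo hi = true) (hle : lo ≤ hi) (hlo0 : 0 < lo)
    {k11 k22 k12 k21 : ℕ} (hk : k11 + k22 = k12 + k21) {x : ℝ} (hlo : (lo : ℝ) ≤ x) (hhi : x ≤ (hi : ℝ)) :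
    evalR (realOf (List.replicate k12 0 ++ r12)) x * evalR (realOf (List.replicate k21 0 ++ r21)) x <
      evalR (realOf (List.replicate k11 0 ++ r11)) x * evalR (realOf (List.replicate k22 0 ++ r22)) x := by
  have hx : 0 < x := lt_of_lt_of_le (by exact_mod_cast hlo0) hlo
  simp only [evalR_realOf_replicate_append]
  exact shifted_minor_lt hx hk (minor_pos_of_posOn hS h hle hlo hhi)

end Summit.CriticalPhenomena.SAWScalingLimit.Theorems.LeftRightFKG.Negative.PolyCert
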